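import Mathlib
import Literature.Barriers.ValiantsHypothesis.AlgebraicNaturalProofs
import Literature.Computability.AlgebraicComplexity.ArithCircuitProofs
import Summits.ValiantsHypothesis.ValiantsHypothesis.Theses.BarrierLever
import Summits.ValiantsHypothesis.ValiantsHypothesis.Theorems.BarrierLeverDiagonalPencilCoeff
import Summits.ValiantsHypothesis.ValiantsHypothesis.Theorems.BarrierLeverDefinableEquationsStubSignGadget

/-!
# Route BarrierLever — item `PrincipalMinorLayoutsNonsingularSuffices` (stmt-ValiantsHypothesis-19133):
# TNS ⇒ `PartitionMinorsHitByVP` via the universal witness `f_K = det (1 + diag(x,y) · K)`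

**Setting (FSV18, tree regime `d = n` over `ℂ`, `n = h + h` variables `x_a = X (Fin.castAdd h a)`,
`y_c = X (Fin.natAdd h c)`).** `PartitionMinorsHitByVP` (stmt-ValiantsHypothesis-19717) asks for an
exponent `b` such that, eventually in `h`, every square minor `[U, W]` of Nisan's `2^h × 2^h`
partition matrix `M_f[u, w] = coeff_{x^u y^w} f` is nonsingular at some `f ∈ SmallCircuits ℂ (h+h) b`.
Conjecture TNS (`PrincipalMinorLayoutsNonsingular`, stmt-ValiantsHypothesis-19126) says that every
square "principal-minor layout matrix" `(det K[u_i ⊔ w_j])_{i,j}` is nonsingular for some numeric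
`K ∈ ℂ^{(h+h)×(h+h)}`.

**Theorem (`partitionMinorsHitByVP_of_principalMinorLayoutsNonsingular`).** TNS ⇒
`PartitionMinorsHitByVP`, with `b = 8` and `h₀ = 8`, by ONE polynomial shape: for the `K` given by
TNS take the diagonal pencil `f_K := det (1 + diag(X) · K) ∈ ℂ[x, y]`. Then
* `coeff_{x^u y^w} f_K = det K[u ⊔ w]` (`coeff_pencil_mono`; the tree's principal-minor expansion
  `DiagonalPencil.diagonalPencilCoeff`, item stmt-19127, at `S = u.map castAddEmb ∪ w.map natAddEmb`,
  whose indicator vector is the exponent of `x^u y^w`, `indicator_joinIdx`), so the partition-matrix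
  minor `[U, W]` of `f_K` IS the principal-minor layout matrix of `K`;
* `deg f_K ≤ h + h` (entries of the pencil have degree `≤ 1`; Leibniz, `SignGadget.totalDegree_det_le`);
* `L(f_K) ≤ 8 (2h+1)^7 + 2 (2h)^2 ≤ (2h)^8` for `h ≥ 8` (entries `[a = b] + X_a · K_{ab}` have
  complexity `≤ 2`; Berkowitz `complexity_detPoly_le` + substitution `complexity_aeval_le`, packaged
  as `SignGadget.complexity_det_le`; the numeric step is `pencil_size_arith`).

The last declaration `principalMinorLayoutsNonsingularSuffices` is the signature of item
stmt-ValiantsHypothesis-19133 VERBATIM (hypothesis TNS inlined; it is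
`PrincipalMinorLayoutsNonsingular` by `Iff.rfl`). Cell valiant-natproofs (planner p1 gen 8,
HOME/p1/PrincipalMinorWitness-g8.lean typed the statements), rung V4.

WHAT THIS IS NOT: conditional on TNS (stmt-19126, open; numerically clean through `h = 7`,
kit j246911 / j247658); says nothing unconditional about `PartitionMinorsHitByVP`, nothing about
torus-balanced read-once determinants in general (items 20152 / 20239), FSV Question 6 / crux
stmt-14610 or `VP` vs `VNP`.

References: [ForbesShpilkaVolk2018] §1.2 / Question 6; N. Nisan, *Lower bounds for non-commutative
computation* (STOC 1991) (the partition matrix); Horn–Johnson, *Matrix Analysis* §0.8.12 (principal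
minor sums); [Burgisser2000] §2.1 (the size measure), [Berkowitz1984] (`DET ∈ VP`).
-/

-- layout Summits/ValiantsHypothesis/ValiantsHypothesis forces the duplicated namespace component
set_option linter.dupNamespace false

open MvPolynomial Finset
open Literature.Computability.AlgebraicComplexity Literature.Barriers.ValiantsHypothesis

namespace Summit.ValiantsHypothesis.ValiantsHypothesis.Theorems.BarrierLever.PrincipalMinorWitness

/-! ## 1. The diagonal pencil `f_K = det (1 + diag(X) · K)` and its entries -/

-- Throughout, the diagonal pencil of `K ∈ ℂ^{n×n}` is the matrix
-- `1 + Matrix.diagonal (fun i : Fin n => X i) * K.map C` over `MvPolynomial (Fin n) ℂ`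
-- (written out in every statement; no definition is introduced).

/-- Entries of the pencil: `(1 + diag(X) K)_{ab} = [a = b] + X_a · K_{ab}`. -/
theorem pencil_apply {n : ℕ} (K : Matrix (Fin n) (Fin n) ℂ) (a b : Fin n) :
    (1 + Matrix.diagonal (fun i : Fin n => (X i : MvPolynomial (Fin n) ℂ)) * K.map C :
      Matrix (Fin n) (Fin n) (MvPolynomial (Fin n) ℂ)) a b
      = C (if a = b then 1 else 0) + X a * C (K a b) := by
  simp only [Matrix.add_apply, Matrix.one_apply, Matrix.diagonal_mul, Matrix.map_apply]
  split_ifs <;> simp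

/-- Every entry of the pencil has total degree `≤ 1`. -/
theorem totalDegree_pencil_apply_le {n : ℕ} (K : Matrix (Fin n) (Fin n) ℂ) (a b : Fin n) :
    ((1 + Matrix.diagonal (fun i : Fin n => (X i : MvPolynomial (Fin n) ℂ)) * K.map C :
      Matrix (Fin n) (Fin n) (MvPolynomial (Fin n) ℂ)) a b).totalDegree ≤ 1 := by
  rw [pencil_apply]
  refine (totalDegree_add _ _).trans (max_le ?_ ?_)
  · rw [totalDegree_C]; exact Nat.zero_le _
  · refine (totalDegree_mul _ _).trans ?_
    rw [totalDegree_X, totalDegree_C]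

/-- Every entry of the pencil has fan-in-two complexity `≤ 2` (one product gate, one sum gate;
variables and constants are free). -/
theorem complexity_pencil_apply_le {n : ℕ} (K : Matrix (Fin n) (Fin n) ℂ) (a b : Fin n) :
    complexity ((1 + Matrix.diagonal (fun i : Fin n => (X i : MvPolynomial (Fin n) ℂ)) * K.map C :
      Matrix (Fin n) (Fin n) (MvPolynomial (Fin n) ℂ)) a b) ≤ 2 := by
  rw [pencil_apply]
  have hC : complexity (C (if a = b then (1 : ℂ) else 0) : MvPolynomial (Fin n) ℂ) = 0 :=
    complexity_C_holds _
  have hX : complexity (X a : MvPolynomial (Fin n) ℂ) = 0 := complexity_X_holds _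
  have hK : complexity (C (K a b) : MvPolynomial (Fin n) ℂ) = 0 := complexity_C_holds _
  have hmul : complexity (X a * C (K a b) : MvPolynomial (Fin n) ℂ) ≤ 1 := by
    refine (complexity_mul_le_holds _ _).trans ?_
    rw [hX, hK]
  refine (complexity_add_le_holds _ _).trans ?_
  rw [hC]
  omega

/-- `deg f_K ≤ n`: the determinant of an `n × n` matrix with entries of degree `≤ 1`. -/
theorem totalDegree_det_pencil_le {n : ℕ} (K : Matrix (Fin n) (Fin n) ℂ) :
    (1 + Matrix.diagonal (fun i : Fin n => (X i : MvPolynomial (Fin n) ℂ)) * K.map C :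
      Matrix (Fin n) (Fin n) (MvPolynomial (Fin n) ℂ)).det.totalDegree ≤ n := by
  have h := BarrierLeverDefinableEquations.SignGadget.totalDegree_det_le (d := 1)
    (1 + Matrix.diagonal (fun i : Fin n => (X i : MvPolynomial (Fin n) ℂ)) * K.map C :
      Matrix (Fin n) (Fin n) (MvPolynomial (Fin n) ℂ))
    (totalDegree_pencil_apply_le K)
  simpa using h

/-- `L(f_K) ≤ 8 (n+1)^7 + 2 n²` (Berkowitz + substitution). -/
theorem complexity_det_pencil_le {n : ℕ} (K : Matrix (Fin n) (Fin n) ℂ) :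
    complexity (1 + Matrix.diagonal (fun i : Fin n => (X i : MvPolynomial (Fin n) ℂ)) * K.map C :
      Matrix (Fin n) (Fin n) (MvPolynomial (Fin n) ℂ)).det
      ≤ 8 * (n + 1) ^ 7 + n * n * 2 :=
  BarrierLeverDefinableEquations.SignGadget.complexity_det_le (c := 2)
    (1 + Matrix.diagonal (fun i : Fin n => (X i : MvPolynomial (Fin n) ℂ)) * K.map C :
      Matrix (Fin n) (Fin n) (MvPolynomial (Fin n) ℂ))
    (complexity_pencil_apply_le K)

/-- The numeric step: `8 (s+1)^7 + 2 s² ≤ s^8` for `s ≥ 16`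
(via `16 (s+1) ≤ 17 s` and `9 · 17^7 ≤ 16^8`). -/
theorem pencil_size_arith (s : ℕ) (hs : 16 ≤ s) : 8 * (s + 1) ^ 7 + s * s * 2 ≤ s ^ 8 := by
  have h1 : 16 * (s + 1) ≤ 17 * s := by omega
  have h2 : (16 * (s + 1)) ^ 7 ≤ (17 * s) ^ 7 := Nat.pow_le_pow_left h1 7
  have h3 : s * s * 2 ≤ (s + 1) ^ 7 := by
    calc s * s * 2 ≤ s * s * s := Nat.mul_le_mul_left _ (by omega)
      _ = s ^ 3 := by ring
      _ ≤ (s + 1) ^ 3 := Nat.pow_le_pow_left (Nat.le_succ s) 3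
      _ ≤ (s + 1) ^ 7 := Nat.pow_le_pow_right (Nat.succ_pos s) (by norm_num)
  have h4 : 8 * (s + 1) ^ 7 + s * s * 2 ≤ 9 * (s + 1) ^ 7 := by omega
  have h5 : 16 ^ 7 * (9 * (s + 1) ^ 7) ≤ 16 ^ 7 * s ^ 8 := by
    calc 16 ^ 7 * (9 * (s + 1) ^ 7) = 9 * (16 * (s + 1)) ^ 7 := by ring
      _ ≤ 9 * (17 * s) ^ 7 := Nat.mul_le_mul_left 9 h2
      _ = (9 * 17 ^ 7) * s ^ 7 := by ring
      _ ≤ 16 ^ 8 * s ^ 7 := Nat.mul_le_mul_right _ (by norm_num)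
      _ = 16 ^ 7 * (16 * s ^ 7) := by ring
      _ ≤ 16 ^ 7 * (s * s ^ 7) := Nat.mul_le_mul_left _ (Nat.mul_le_mul_right _ hs)
      _ = 16 ^ 7 * s ^ 8 := by ring
  exact h4.trans (Nat.le_of_mul_le_mul_left h5 (by norm_num))

/-- **`f_K ∈ SmallCircuits ℂ (h+h) 8` for `h ≥ 8`.** -/
theorem det_pencil_mem_smallCircuits {h : ℕ} (hh : 8 ≤ h) (K : Matrix (Fin (h + h)) (Fin (h + h)) ℂ) :
    (1 + Matrix.diagonal (fun i : Fin (h + h) => (X i : MvPolynomial (Fin (h + h)) ℂ)) * K.map C :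
      Matrix (Fin (h + h)) (Fin (h + h)) (MvPolynomial (Fin (h + h)) ℂ)).det
      ∈ SmallCircuits ℂ (h + h) 8 := by
  refine ⟨totalDegree_det_pencil_le K, (complexity_det_pencil_le K).trans ?_⟩
  exact pencil_size_arith (h + h) (by omega)

/-! ## 2. The partition-matrix minors of `f_K` are the principal-minor layout matrices of `K` -/

/-- The exponent vector of `x^u y^w` is the indicator vector of the index set
`u.map castAddEmb ∪ w.map natAddEmb ⊆ Fin (h + h)`. -/
theorem indicator_joinIdx (h : ℕ) (u w : Finset (Fin h)) :
    (∑ s ∈ u.map (Fin.castAddEmb h) ∪ w.map (Fin.natAddEmb h), Finsupp.single s 1 :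
        Fin (h + h) →₀ ℕ)
      = ∑ a ∈ u, Finsupp.single (Fin.castAdd h a) 1 + ∑ c ∈ w, Finsupp.single (Fin.natAdd h c) 1 := by
  have hdisj : Disjoint (u.map (Fin.castAddEmb h)) (w.map (Fin.natAddEmb h)) := by
    rw [Finset.disjoint_left]
    intro s hs hs'
    obtain ⟨a, _, rfl⟩ := Finset.mem_map.1 hs
    obtain ⟨c, _, hc⟩ := Finset.mem_map.1 hs'
    have hv := congrArg Fin.val hc
    simp only [Fin.natAddEmb_apply, Fin.castAddEmb_apply, Fin.val_natAdd, Fin.val_castAdd] at hv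
    have ha := a.isLt
    omega
  rw [Finset.sum_union hdisj, Finset.sum_map, Finset.sum_map]
  rfl

/-- **Coefficient identity**: `coeff_{x^u y^w} f_K = det K[u ⊔ w]` (item `DiagonalPencilCoeff`,
stmt-19127, at the index set `u ⊔ w`). -/
theorem coeff_pencil_mono (h : ℕ) (K : Matrix (Fin (h + h)) (Fin (h + h)) ℂ) (u w : Finset (Fin h)) :
    MvPolynomial.coeff
        (∑ a ∈ u, Finsupp.single (Fin.castAdd h a) 1 + ∑ c ∈ w, Finsupp.single (Fin.natAdd h c) 1)
        (1 + Matrix.diagonal (fun i : Fin (h + h) => (X i : MvPolynomial (Fin (h + h)) ℂ)) * K.map C :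
      Matrix (Fin (h + h)) (Fin (h + h)) (MvPolynomial (Fin (h + h)) ℂ)).det
      = (K.submatrix (Subtype.val : ↥(u.map (Fin.castAddEmb h) ∪ w.map (Fin.natAddEmb h)) → Fin (h + h))
          (Subtype.val : ↥(u.map (Fin.castAddEmb h) ∪ w.map (Fin.natAddEmb h)) → Fin (h + h))).det := by
  rw [← indicator_joinIdx]
  exact DiagonalPencil.diagonalPencilCoeff (h + h) K _

/-! ## 3. TNS ⇒ `PartitionMinorsHitByVP` -/

/-- **TNS ⇒ `PartitionMinorsHitByVP`** (`b = 8`, `h₀ = 8`; witness `f_K = det (1 + diag(x,y) K)`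
for the `K` supplied by TNS for the layout `(u, w)`). -/
theorem partitionMinorsHitByVP_of_principalMinorLayoutsNonsingular
    (hTNS : Summit.ValiantsHypothesis.ValiantsHypothesis.Theses.BarrierLever.PrincipalMinorLayoutsNonsingular) :
    Summit.ValiantsHypothesis.ValiantsHypothesis.Theses.BarrierLever.PartitionMinorsHitByVP := by
  refine ⟨8, 8, fun h hh r u w hu hw => ?_⟩
  obtain ⟨K, hK⟩ := hTNS h r u w hu hw
  refine ⟨(1 + Matrix.diagonal (fun i : Fin (h + h) => (X i : MvPolynomial (Fin (h + h)) ℂ)) * K.map C :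
      Matrix (Fin (h + h)) (Fin (h + h)) (MvPolynomial (Fin (h + h)) ℂ)).det,
    det_pencil_mem_smallCircuits hh K, ?_⟩
  have hmat : (Matrix.of fun i j : Fin r => MvPolynomial.coeff
        (∑ a ∈ u i, Finsupp.single (Fin.castAdd h a) 1 + ∑ c ∈ w j, Finsupp.single (Fin.natAdd h c) 1)
        (1 + Matrix.diagonal (fun i : Fin (h + h) => (X i : MvPolynomial (Fin (h + h)) ℂ)) * K.map C :
      Matrix (Fin (h + h)) (Fin (h + h)) (MvPolynomial (Fin (h + h)) ℂ)).det)
      = Matrix.of fun i j : Fin r =>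
        (K.submatrix (Subtype.val : ↥((u i).map (Fin.castAddEmb h) ∪ (w j).map (Fin.natAddEmb h)) → Fin (h + h))
          (Subtype.val : ↥((u i).map (Fin.castAddEmb h) ∪ (w j).map (Fin.natAddEmb h)) → Fin (h + h))).det := by
    ext i j
    simp only [Matrix.of_apply]
    exact coeff_pencil_mono h K (u i) (w j)
  rw [hmat]
  exact hK

/-- **Item `PrincipalMinorLayoutsNonsingularSuffices` (stmt-ValiantsHypothesis-19133), signature
verbatim** (the hypothesis is `PrincipalMinorLayoutsNonsingular`, stmt-19126, inlined). -/
theorem principalMinorLayoutsNonsingularSuffices :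
    (∀ (h r : ℕ) (u w : Fin r → Finset (Fin h)), Function.Injective u → Function.Injective w → ∃ K : Matrix (Fin (h + h)) (Fin (h + h)) ℂ, (Matrix.of fun i j : Fin r => (K.submatrix (Subtype.val : ↥((u i).map (Fin.castAddEmb h) ∪ (w j).map (Fin.natAddEmb h)) → Fin (h + h)) (Subtype.val : ↥((u i).map (Fin.castAddEmb h) ∪ (w j).map (Fin.natAddEmb h)) → Fin (h + h))).det).det ≠ 0) → Summit.ValiantsHypothesis.ValiantsHypothesis.Theses.BarrierLever.PartitionMinorsHitByVP :=
  fun hTNS => partitionMinorsHitByVP_of_principalMinorLayoutsNonsingular hTNS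

/-- Sanity: the verbatim signature is `PrincipalMinorLayoutsNonsingular → PartitionMinorsHitByVP`. -/
example : (Summit.ValiantsHypothesis.ValiantsHypothesis.Theses.BarrierLever.PrincipalMinorLayoutsNonsingular →
    Summit.ValiantsHypothesis.ValiantsHypothesis.Theses.BarrierLever.PartitionMinorsHitByVP) :=
  principalMinorLayoutsNonsingularSuffices

end Summit.ValiantsHypothesis.ValiantsHypothesis.Theorems.BarrierLever.PrincipalMinorWitness
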